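import Summits.ValiantsHypothesis.ValiantsHypothesis.Theses.DepthWindow
import Summits.ValiantsHypothesis.ValiantsHypothesis.Theorems.DepthWindowSlopeRateCore
import HarnessLib

/-!
# Route `DepthWindow`, gen-3 split of `PerHardLog3` — the glue `PerHardLog3Glue3` holds

`PerHardLog3Glue3` (item stmt-ValiantsHypothesis-30637) = `HomImmHardTwoOne → HomTwoOne → PerHardLog3`:
the slope-`2` instance of the dial law (homogenise `IMM_{m,⌊√log₂ m⌋}`-level circuits at slope `2`,
then apply homogeneous hardness at slope `2`; VNP-completeness transport along towers `m = 2^2^2^Y`).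
Kernel: `perHardLog3_of_two_core` (route-independent module `DepthWindowSlopeRateCore.lean`), with the
two hypotheses swapped into the gate's crux-first order.
[cite: LimayeSrinivasanTavenas2025, Lemma 11, Lemma 12, Cor. 4] [cite: BhargavDuttaSaxena2024, Thm. 1.4]
-/

-- layout Summits/ValiantsHypothesis/ValiantsHypothesis forces the duplicated namespace component
set_option linter.dupNamespace false

namespace Summit.ValiantsHypothesis.ValiantsHypothesis.Theorems.DepthWindow

/-- The glue of the gen-3 split of `PerHardLog3` holds: `HomImmHardTwoOne → HomTwoOne → PerHardLog3`.
[cite: LimayeSrinivasanTavenas2025, Lemma 11, Lemma 12] [cite: BhargavDuttaSaxena2024, Thm. 1.4] -/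
theorem perHardLog3Glue3_holds :
    Summit.ValiantsHypothesis.ValiantsHypothesis.Theses.DepthWindow.PerHardLog3Glue3 :=
  fun hHard hHom => perHardLog3_of_two_core hHom hHard

end Summit.ValiantsHypothesis.ValiantsHypothesis.Theorems.DepthWindow
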